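import Summits.Ventures.HSemireg.ObstructionLocusGraph

/-!
# Venture HSemireg — (S5) OBSTRUCTION LOCUS away from secant type, II: the KODAIRA PIECE at the reducible point —
# rank `C(n,2)` on the principally-polarised directions, kernel = the `n` factor directions, `h¹(N′_W) = n(n−1)(n−2)`

HONEST FRAMING.  Part of the Lean side of the computation cell `pub-hsemireg` (track «S4-PUSH» (ii), seat s4-prove-2):
the CLOSED-FORM DIMENSIONS of STRUCTURE.md §2 (S5)/(S-B)(a) = §1.1 C7(a) («obstruction = the KODAIRA piece
`π_* : Sym² → H¹(W, N′_W)`, rank `C(n,2)`, `h¹(N′_W) = n(n−1)(n−2)`, non-zero exactly on the `C(n,2)` mixed pp directions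
`θ_ab + θ_ba`, zero on the `n` diagonal ones») as kernel theorems of the finite model of `ObstructionLocusGraph.lean`,
for EVERY `n ≥ 3` (the engine table n = 3..8: rank 3, 6, 10, 15, 21, 28; `h¹` = 6, 24, 60, 120, 210, 336 is the list of
instances).  Nothing here constructs `W`, `N′_W` or an obstruction class; the identification of the first-order
obstruction with this map is the named hypothesis (H-arr) of file I (Lemma L1 + Prop. K); nothing here says that
HC / HC_CM / HC_AV holds; no Literature fact is declared or used; arbitrary field `K`.

THE MODEL (G2-REDUCIBLE-POINT-THEOREM.md §2 L1(i), §3 COUNT).  `W = ⋃_{|F|=2} B_F ⊂ X = E₁ × ⋯ × Eₙ`, `B_F = {x_i = x_j =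
0}` (`F = {i,j}`); by L1(i) `N′_W = ⊕_F ν_* N_{B_F}` and `H¹(W, N′_W) = ⊕_F H¹(B_F, 𝒪) ⊗ ⟨∂_l : l ∈ F⟩` with basis
`[dz̄_k|_{B_F}] ⊗ ∂_l`, `k ∉ F ∋ l`; writing `F = {l, c}` the basis is indexed by the PAIRWISE DISTINCT triples
`(k, l, c)` (`WIndex n`, `card_WIndex : n(n−1)(n−2)`), and `π_* ξ` has `(k,l,c)`-component `ξ_kl` (`kodairaMap`).
The pp directions `ξ = Σ_a d_a θ_aa + Σ_{F={a,b}} s_F (θ_ab + θ_ba)` are coordinatised by `(d, s) ∈ Kⁿ × K^{C(n,2)}`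
(`PPData`, `ppDirOf`; `ppDirOf_injective`, `range_ppDirOf` = exactly the symmetric matrices, `finrank_PPData = n + C(n,2)`).

PROVED HERE (kernel): `forall_follows_iff_kodairaMap_eq_zero` (the map IS the branch criterion of file I, every `n`);
`kodairaMap_eq_zero_iff` / `ker_kodairaMap` / `finrank_ker_kodairaMap = n` (kernel = the diagonal = the `n` factor
moduli, `n ≥ 3`); `finrank_range_kodairaMap = n(n−1)` (rank on all of `H¹(T_X)`); `kodairaMap_ppDirOf_eq_zero_iff`
(on pp directions: `π_* ξ(d,s) = 0 ⟺ s = 0` — «W follows exactly the n-dimensional product sub-locus of 𝒜ₙ»);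
**`finrank_range_kodairaMap_pp = C(n,2)`** (THE KODAIRA PIECE); `kodairaMap_ppDir_ne_zero` (each mixed direction IS
obstructed), `kodairaMap_theta_self` (each factor direction is not).  With file I's `ReduciblePointObject` this is the
dimension count behind `not_semiregular_of_pair_type`: the obstruction locus in `Sym²` is the complement of the
diagonal, of codimension / rank exactly `C(n,2)` = `#edges K_n` (`card_edgeFinset_fullGraph`).
References (dictionary only): G2-REDUCIBLE-POINT-THEOREM.md 33fa34ed1ce6a619 §2–§3 and g2/obstruction_table.json
(n = 2..8); Altmann–Christophersen (T¹ of Stanley–Reisner rings, nearest prior art); STRUCTURE.md §1.1 C7(a), §2 (S-B).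
-/

open scoped BigOperators
open Finset

namespace Summit.Ventures.HSemireg.ObstructionLocus

variable {K : Type*} [Field K] {n : ℕ}

/-! ## The Kodaira piece at the reducible point `W = ⋃_{|F| = 2} B_F` -/

/-- Index of the basis `{[dz̄_k|_{B_F}] ⊗ ∂_l : F = {l, c}, k ∉ F}` of `H¹(W, N′_W) = ⊕_F H¹(B_F, N_{B_F})`:
triples `(k, l, c)` of pairwise distinct coordinates (`k` = the `dz̄` index, `l` = the normal-field index,
`c` = the other coordinate cut out by the branch). -/
abbrev WIndex (n : ℕ) : Type :=
  {t : Fin n × Fin n × Fin n // t.1 ≠ t.2.1 ∧ t.1 ≠ t.2.2 ∧ t.2.1 ≠ t.2.2}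

/-- The Kodaira obstruction map `π_* : H¹(T_X) → H¹(W, N′_W)` in coordinates: the `(k, l, c)`-component of
`π_* ξ` is `ξ_kl`. -/
def kodairaMap : Dir K n →ₗ[K] (WIndex n → K) where
  toFun ξ t := ξ t.1.1 t.1.2.1
  map_add' _ _ := rfl
  map_smul' _ _ := rfl

/-- Components of the Kodaira map. -/
@[simp] theorem kodairaMap_apply (ξ : Dir K n) (t : WIndex n) : kodairaMap ξ t = ξ t.1.1 t.1.2.1 := rfl

/-- `h¹(N′_W) = n(n-1)(n-2)` — the size of the Kodaira target (n = 3, …, 8: 6, 24, 60, 120, 210, 336). -/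
theorem card_WIndex (n : ℕ) : Fintype.card (WIndex n) = n * (n - 1) * (n - 2) := by
  classical
  let e : WIndex n ≃ Σ q : {q : Fin n × Fin n // q.1 ≠ q.2}, {k : Fin n // k ≠ q.1.1 ∧ k ≠ q.1.2} :=
    { toFun := fun t => ⟨⟨(t.1.2.1, t.1.2.2), t.2.2.2⟩, ⟨t.1.1, t.2.1, t.2.2.1⟩⟩
      invFun := fun s => ⟨(s.2.1, s.1.1.1, s.1.1.2), s.2.2.1, s.2.2.2, s.1.2⟩
      left_inv := fun _ => rfl
      right_inv := fun _ => rfl }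
  rw [Fintype.card_congr e, Fintype.card_sigma]
  have hfib : ∀ q : {q : Fin n × Fin n // q.1 ≠ q.2},
      Fintype.card {k : Fin n // k ≠ q.1.1 ∧ k ≠ q.1.2} = n - 2 := by
    intro q
    rw [Fintype.card_subtype]
    have : (Finset.univ.filter fun k : Fin n => k ≠ q.1.1 ∧ k ≠ q.1.2)
        = ((Finset.univ : Finset (Fin n)).erase q.1.1).erase q.1.2 := by
      ext k; simp [Finset.mem_erase, and_comm]
    have hmem : q.1.2 ∈ (Finset.univ : Finset (Fin n)).erase q.1.1 := by
      simpa [Finset.mem_erase] using q.2.symm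
    rw [this, Finset.card_erase_of_mem hmem, Finset.card_erase_of_mem (Finset.mem_univ _), Finset.card_univ,
      Fintype.card_fin]
    omega
  simp only [hfib, Finset.sum_const, smul_eq_mul, Finset.card_univ]
  have hq : Fintype.card {q : Fin n × Fin n // q.1 ≠ q.2} = n * n - n := by
    rw [Fintype.card_subtype]
    have : (Finset.univ.filter fun q : Fin n × Fin n => q.1 ≠ q.2) = (Finset.univ : Finset (Fin n)).offDiag := by
      ext q; simp [Finset.mem_offDiag]
    rw [this, Finset.offDiag_card, Finset.card_univ, Fintype.card_fin]
  rw [hq, ← Nat.mul_sub_one]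

/-- **The Kodaira map and the branch criterion agree**: `W` follows `ξ` (every branch `B_F`, `|F| = 2`, does)
iff `π_* ξ = 0` — for every `n`. -/
theorem forall_follows_iff_kodairaMap_eq_zero (ξ : Dir K n) :
    (∀ F : Finset (Fin n), F.card = 2 → Follows F ξ) ↔ kodairaMap ξ = 0 := by
  constructor
  · intro h
    funext t
    obtain ⟨⟨k, l, c⟩, hkl, hkc, hlc⟩ := t
    simp only [kodairaMap_apply, Pi.zero_apply]
    refine h {l, c} (Finset.card_pair hlc) k ?_ l (by simp)
    simp [hkl, hkc]
  · intro h F hF k hk l hl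
    obtain ⟨a, b, hab, rfl⟩ := Finset.card_eq_two.1 hF
    simp only [Finset.mem_insert, Finset.mem_singleton, not_or] at hk hl
    rcases hl with rfl | rfl
    · exact congr_fun h ⟨(k, l, b), hk.1, hk.2, hab⟩
    · exact congr_fun h ⟨(k, l, a), hk.2, hk.1, Ne.symm hab⟩

/-- **Kernel of the Kodaira map** (`n ≥ 3`): `π_* ξ = 0` iff all off-diagonal coefficients vanish. -/
theorem kodairaMap_eq_zero_iff (hn : 3 ≤ n) (ξ : Dir K n) :
    kodairaMap ξ = 0 ↔ ∀ k l, k ≠ l → ξ k l = 0 := by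
  constructor
  · intro h k l hkl
    obtain ⟨c, hck, hcl⟩ := Fin.exists_ne_and_ne_of_two_lt k l hn
    exact congr_fun h ⟨(k, l, c), hkl, hck.symm, hcl.symm⟩
  · intro h
    funext t
    exact h _ _ t.2.1

/-- Equivalently: the kernel is the space of diagonal matrices, the span of the `n` factor directions `θ_aa`. -/
theorem ker_kodairaMap (hn : 3 ≤ n) :
    LinearMap.ker (kodairaMap (K := K) (n := n)) = LinearMap.range (Matrix.diagonalLinearMap (Fin n) K K) := by
  ext ξ
  rw [LinearMap.mem_ker, kodairaMap_eq_zero_iff hn, LinearMap.mem_range]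
  constructor
  · intro h
    refine ⟨fun a => ξ a a, ?_⟩
    ext k l
    by_cases hkl : k = l
    · subst hkl; simp
    · simp [Matrix.diagonal_apply_ne _ hkl, h k l hkl]
  · rintro ⟨d, rfl⟩ k l hkl
    simp [Matrix.diagonal_apply_ne _ hkl]

/-- `dim ker π_* = n` (the `n` factor moduli). -/
theorem finrank_ker_kodairaMap (hn : 3 ≤ n) :
    Module.finrank K (LinearMap.ker (kodairaMap (K := K) (n := n))) = n := by
  rw [ker_kodairaMap hn, LinearMap.finrank_range_of_inj]
  · simp
  · intro d d' h
    exact Matrix.diagonal_injective (by simpa using h)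

/-- **Rank of the Kodaira map on all of `H¹(T_X)`**: `n(n-1)` (`n ≥ 3`). -/
theorem finrank_range_kodairaMap (hn : 3 ≤ n) :
    Module.finrank K (LinearMap.range (kodairaMap (K := K) (n := n))) = n * (n - 1) := by
  have h := LinearMap.finrank_range_add_finrank_ker (kodairaMap (K := K) (n := n))
  rw [finrank_ker_kodairaMap hn, Module.finrank_matrix] at h
  simp only [Fintype.card_fin, Module.finrank_self, mul_one] at h
  rw [Nat.mul_sub_one]
  omega

/-! ### Principally-polarised (symmetric) directions: `ξ = Σ_a d_a θ_aa + Σ_{F = {a,b}} s_F (θ_ab + θ_ba)` -/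

/-- Unordered pairs of coordinates (the `C(n,2)` mixed pp directions). -/
abbrev Pair (n : ℕ) : Type := {F : Finset (Fin n) // F.card = 2}

/-- The pair `{k, l}` for `k ≠ l`. -/
def pairOf (k l : Fin n) (h : k ≠ l) : Pair n := ⟨{k, l}, Finset.card_pair h⟩

/-- `{k, l} = {l, k}` as pairs. -/
theorem pairOf_comm (k l : Fin n) (h : k ≠ l) : pairOf k l h = pairOf l k (Ne.symm h) :=
  Subtype.ext (Finset.pair_comm k l)

/-- Coordinates of a pp direction: diagonal part `d` and mixed part `s`. -/
abbrev PPData (K : Type*) [Field K] (n : ℕ) : Type _ := (Fin n → K) × (Pair n → K)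

/-- `(d, s) ↦ Σ_a d_a θ_aa + Σ_{F = {a,b}} s_F (θ_ab + θ_ba)`. -/
def ppDirOf : PPData K n →ₗ[K] Dir K n where
  toFun ds := Matrix.of fun k l => if h : k = l then ds.1 k else ds.2 (pairOf k l h)
  map_add' x y := by
    ext k l
    by_cases h : k = l <;> simp [h]
  map_smul' c x := by
    ext k l
    by_cases h : k = l <;> simp [h]

/-- Diagonal entries of `ξ(d, s)`: `d`. -/
theorem ppDirOf_apply_diag (ds : PPData K n) (k : Fin n) : ppDirOf ds k k = ds.1 k := by
  simp [ppDirOf]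

/-- Off-diagonal entries of `ξ(d, s)`: `s_{kl}`. -/
theorem ppDirOf_apply_ne (ds : PPData K n) {k l : Fin n} (h : k ≠ l) :
    ppDirOf ds k l = ds.2 (pairOf k l h) := by
  simp [ppDirOf, h]

/-- pp directions are symmetric (`ξ ⌟ b = 0 ⟺ ξ = ξᵀ` at the product polarisation). -/
theorem ppDirOf_isSymm (ds : PPData K n) : (ppDirOf ds).IsSymm := by
  ext k l
  rw [Matrix.transpose_apply]
  by_cases h : k = l
  · subst h; rfl
  · rw [ppDirOf_apply_ne ds h, ppDirOf_apply_ne ds (Ne.symm h), pairOf_comm]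

/-- Every symmetric direction has pp coordinates. -/
theorem exists_ppDirOf_eq_of_isSymm {ξ : Dir K n} (hξ : ξ.IsSymm) : ∃ ds : PPData K n, ppDirOf ds = ξ := by
  classical
  have hne : ∀ F : Pair n, F.1.Nonempty := fun F => Finset.card_pos.1 (by rw [F.2]; norm_num)
  refine ⟨(fun a => ξ a a, fun F => ξ (F.1.min' (hne F)) (F.1.max' (hne F))), ?_⟩
  ext k l
  by_cases h : k = l
  · subst h; exact ppDirOf_apply_diag _ _
  · rw [ppDirOf_apply_ne _ h]
    simp only
    set F : Pair n := pairOf k l h with hF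
    have hmin : F.1.min' (hne F) ∈ ({k, l} : Finset (Fin n)) := Finset.min'_mem _ _
    have hmax : F.1.max' (hne F) ∈ ({k, l} : Finset (Fin n)) := Finset.max'_mem _ _
    have hlt : F.1.min' (hne F) < F.1.max' (hne F) := Finset.min'_lt_max'_of_card _ (by rw [F.2]; norm_num)
    simp only [Finset.mem_insert, Finset.mem_singleton] at hmin hmax
    rcases hmin with hmin | hmin <;> rcases hmax with hmax | hmax
    · rw [hmin, hmax] at hlt; exact absurd hlt (lt_irrefl _)
    · rw [hmin, hmax]
    · rw [hmin, hmax]; exact hξ.apply k l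
    · rw [hmin, hmax] at hlt; exact absurd hlt (lt_irrefl _)

/-- `ppDirOf` is injective: `(d, s)` are honest coordinates on the pp directions. -/
theorem ppDirOf_injective : Function.Injective (ppDirOf (K := K) (n := n)) := by
  intro x y h
  refine Prod.ext (funext fun a => ?_) (funext fun F => ?_)
  · rw [← ppDirOf_apply_diag x a, ← ppDirOf_apply_diag y a, h]
  · obtain ⟨a, b, hab, hF⟩ := Finset.card_eq_two.1 F.2
    have hF' : F = pairOf a b hab := Subtype.ext hF
    rw [hF', ← ppDirOf_apply_ne x hab, ← ppDirOf_apply_ne y hab, h]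

/-- The image of `ppDirOf` is exactly the space of symmetric directions. -/
theorem range_ppDirOf :
    (LinearMap.range (ppDirOf (K := K) (n := n)) : Set (Dir K n)) = {ξ | ξ.IsSymm} := by
  ext ξ
  simp only [SetLike.mem_coe, LinearMap.mem_range, Set.mem_setOf_eq]
  constructor
  · rintro ⟨ds, rfl⟩; exact ppDirOf_isSymm ds
  · exact exists_ppDirOf_eq_of_isSymm

/-- `dim {pp directions} = n + C(n,2) = n(n+1)/2`. -/
theorem finrank_PPData : Module.finrank K (PPData K n) = n + n.choose 2 := by
  rw [Module.finrank_prod, Module.finrank_fintype_fun_eq_card, Module.finrank_fintype_fun_eq_card,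
    Fintype.card_fin, Fintype.card_finset_len, Fintype.card_fin]

/-- The Kodaira map in pp coordinates reads off the MIXED coefficient: component `(k, l, c)` of
`π_* ξ(d, s)` is `s_{kl}`. -/
theorem kodairaMap_ppDirOf_apply (ds : PPData K n) (t : WIndex n) :
    kodairaMap (ppDirOf ds) t = ds.2 (pairOf t.1.1 t.1.2.1 t.2.1) := by
  rw [kodairaMap_apply, ppDirOf_apply_ne]

/-- **Kernel on pp directions** (`n ≥ 3`): `π_* ξ(d, s) = 0 ⟺ s = 0` — `W` follows exactly the `n` diagonal
(factor) directions. -/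
theorem kodairaMap_ppDirOf_eq_zero_iff (hn : 3 ≤ n) (ds : PPData K n) :
    kodairaMap (ppDirOf ds) = 0 ↔ ds.2 = 0 := by
  constructor
  · intro h
    funext F
    obtain ⟨a, b, hab, hF⟩ := Finset.card_eq_two.1 F.2
    obtain ⟨c, hca, hcb⟩ := Fin.exists_ne_and_ne_of_two_lt a b hn
    have := congr_fun h ⟨(a, b, c), hab, hca.symm, hcb.symm⟩
    rw [kodairaMap_ppDirOf_apply] at this
    rw [show F = pairOf a b hab from Subtype.ext hF]
    simpa using this
  · intro h
    funext t
    rw [kodairaMap_ppDirOf_apply, h]; rfl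

/-- The kernel of `π_*` on pp coordinates is `{s = 0}`. -/
theorem ker_kodairaMap_comp_ppDirOf (hn : 3 ≤ n) :
    LinearMap.ker (kodairaMap ∘ₗ ppDirOf (K := K) (n := n)) = LinearMap.ker (LinearMap.snd K _ _) := by
  ext ds
  simp only [LinearMap.mem_ker, LinearMap.coe_comp, Function.comp_apply, LinearMap.snd_apply]
  exact kodairaMap_ppDirOf_eq_zero_iff hn ds

/-- `dim ker (π_*|pp) = n`. -/
theorem finrank_ker_kodairaMap_pp (hn : 3 ≤ n) :
    Module.finrank K (LinearMap.ker (kodairaMap ∘ₗ ppDirOf (K := K) (n := n))) = n := by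
  rw [ker_kodairaMap_comp_ppDirOf hn, LinearMap.ker_snd, LinearMap.finrank_range_of_inj LinearMap.inl_injective,
    Module.finrank_fintype_fun_eq_card, Fintype.card_fin]

/-- **THE KODAIRA PIECE (S5 / S-B (a)): rank `C(n,2)` on the principally-polarised directions**, `n ≥ 3`
(n = 3, …, 8: 3, 6, 10, 15, 21, 28). -/
theorem finrank_range_kodairaMap_pp (hn : 3 ≤ n) :
    Module.finrank K (LinearMap.range (kodairaMap ∘ₗ ppDirOf (K := K) (n := n))) = n.choose 2 := by
  have h := LinearMap.finrank_range_add_finrank_ker (kodairaMap ∘ₗ ppDirOf (K := K) (n := n))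
  rw [finrank_ker_kodairaMap_pp hn, finrank_PPData] at h
  omega

/-- The mixed direction `θ_ab + θ_ba` (`a ≠ b`) IS obstructed: `π_*(θ_ab + θ_ba) ≠ 0` (`n ≥ 3`). -/
theorem kodairaMap_ppDir_ne_zero (hn : 3 ≤ n) {a b : Fin n} (hab : a ≠ b) :
    kodairaMap (ppDir a b : Dir K n) ≠ 0 := by
  obtain ⟨c, hca, hcb⟩ := Fin.exists_ne_and_ne_of_two_lt a b hn
  intro h
  have := congr_fun h ⟨(a, b, c), hab, hca.symm, hcb.symm⟩
  simp [ppDir, theta, Matrix.add_apply, hab] at this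

/-- The factor direction `θ_aa` is unobstructed: `π_* θ_aa = 0` (every `n`). -/
theorem kodairaMap_theta_self (a : Fin n) : kodairaMap (theta a a : Dir K n) = 0 := by
  funext t
  have : ¬ (a = t.1.1 ∧ a = t.1.2.1) := by rintro ⟨h1, h2⟩; exact t.2.1 (h1.symm.trans h2)
  simp [theta, this]

/-! ### The obstruction locus in `Follows` language (every branch of `W`) -/

/-- `W` follows every factor direction `θ_aa` (every `n`). -/
theorem W_follows_theta_self (a : Fin n) : ∀ F : Finset (Fin n), F.card = 2 → Follows F (theta a a : Dir K n) :=
  fun F _ => follows_theta_self F a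

/-- `W` does NOT follow the mixed pp direction `θ_ab + θ_ba` (`a ≠ b`, `n ≥ 3`): some branch `B_{{b,c}}`, `c ∉ {a,b}`, is
obstructed — the `C(n,2)` obstructed directions of GSOB-n3/n4/n5-01 (3, 6, 10), for every `n`. -/
theorem not_W_follows_ppDir (hn : 3 ≤ n) {a b : Fin n} (hab : a ≠ b) :
    ¬ ∀ F : Finset (Fin n), F.card = 2 → Follows F (ppDir a b : Dir K n) := by
  rw [forall_follows_iff_kodairaMap_eq_zero]
  exact kodairaMap_ppDir_ne_zero hn hab

/-- Explicitly: the branch `B_{{b,c}}` (`c ≠ a`; for `c ≠ b` a genuine branch of `W`) is obstructed along `θ_ab + θ_ba`. -/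
theorem not_follows_pair_ppDir {a b c : Fin n} (hab : a ≠ b) (hca : c ≠ a) :
    ¬ Follows ({b, c} : Finset (Fin n)) (ppDir a b : Dir K n) := by
  rw [follows_ppDir_iff hab, not_not]
  refine Or.inr ⟨?_, by simp⟩
  simp [hab, Ne.symm hca]

/-- **The follow-set of `W` inside the pp directions is exactly the diagonal** (`n ≥ 3`): `W` follows `ξ(d, s)` iff
`s = 0` — «`W` (and `Z_d`) follows to first order exactly the `n`-dimensional product sub-locus of `𝒜ₙ` and is obstructed
along the other `C(n,2)` principally-polarised directions». -/
theorem W_follows_ppDirOf_iff (hn : 3 ≤ n) (ds : PPData K n) :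
    (∀ F : Finset (Fin n), F.card = 2 → Follows F (ppDirOf ds)) ↔ ds.2 = 0 := by
  rw [forall_follows_iff_kodairaMap_eq_zero, kodairaMap_ppDirOf_eq_zero_iff hn]

end Summit.Ventures.HSemireg.ObstructionLocus
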